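import Summits.QuantumFields.YangMills.Theorems.BalabanUVNodesN22AtRecordOfGenAnalyticReadingRoad1Max
import Summits.QuantumFields.YangMills.Theorems.BalabanUVNodesN10GenAnalyticReadingOfTermwise226
import Summits.QuantumFields.YangMills.Theorems.BalabanUVNodesN10OlderTermsBanachSectionAtTableGerms

/-!
# BalabanUVNodes ∕ node N22 = NE9 — ROAD 1 (first order, max clause `max(ω₁, 4M_b c_w∕ϱ) ≤ ℓ.ω`) AT THE RECORD FOR def-W1's (2.14) TERM DATA READ ON N10's TABLE-GERM
# CARRIER: module J65 with the term-level analytic reading (`A hGA hA hMbA`), (AR-adm)∕(AR-dom₁) and (Adm-run) DISCHARGED BY NAME from N10's modules 102 §3 ∕ 105 ∕ 106 and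
# def-W1's `RecAdmissible` — NO node-N18 letter, NO last-coupling SECTOR row; residual = laws + `hT` per term + the FIRST-ORDER real last-coupling Lipschitz row

Cell `pub-ymgap`, HUMAN RULING D-0062 (Track A), R134 seat `pub-ymgap-dag-n22-c` (strategy s1: «the history-Lipschitz estimate (2.40)–(2.41) p. 21 of [II] on the W1 object»), generation
19, module J71.  THEOREMS ONLY (no `def`, no `sorry`, standard axioms); `--kind proof --supports stmt-QuantumFields-27366 --as helper` (K3⁸ `SpineGivenEndpointR13SepCoPHV`), COUNT-NEUTRAL.
Imports this lane's module J65 `…N22AtRecordOfGenAnalyticReadingRoad1Max` (ROAD 1 at the record from the analytic reading read directly, max clause) and node N10's modules 102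
`…N10GenAnalyticReadingOfTermwise226` (§3 `exists_genAnalyticReading_termData_of_termwise226`) and 106 `…N10OlderTermsBanachSectionAtTableGerms` (through it module 105
`B13OlderTermsTableGerms`).  Nothing re-declared; consumed BY NAME.

WHY (the ROAD-1 twin of modules J68∕J69).  ROAD 1 (J55∕J61∕J64∕J65) closes K3's `h9` from FIRST-ORDER letters alone — no N18 kernel step rate, no second differences, no sector
holomorphy in the complex last coupling (so NOT the unprinted centred vertex letter (S-vertex-T′)) — at the price of the clause `max(ω₁, 4M_b c_w∕ϱ) ≤ ℓ.ω` and FADING level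
weights `aw K k j ≤ c_w ω₁^{k−j}`.  Its older-term input is the TERM-level analytic reading `A hGA hA hMbA` + (AR-adm) + (AR-dom₁) + (Adm-run); at def-W1's term data read on
N10's table-germ carrier these are N10's module 102 §3 (from the reading section `hcv` + the per-term row `hT`, rate `κ_E = r₁`, `M_b ≥ e·9·64·K₀(64,8)²·C₃ε₁`), module 105's
ALL-LEVEL rows on the class `AdmHist ∧ (old 0 = 0)` (the level-`0` device of J68), and def-W1's `RecAdmissible` + `recTerm_zero`.
* §1 ★★★ `ne9_EA_objectsOfRecord₁₃_of_termDataTableGermsRoad1Max` — K3's `h9` from: (1.21) `hlim`; W1-20's law `hloc` at the run towers of `(𝔇 K).Gn`; open tables; `RecAdmissible`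
  on `D K ⊇ ]0, γ]`; the reading section `hcv` (rate `r₁`); PER TERM `hT`; `Lemma3Numerics`, `0 ≤ C₃ε₁`, the two [KP86] clauses, renewal `… ≤ M_b`; level weights `0 < aw ≤ c_w`,
  `aw K k j ≤ c_w ω₁^{k−j}`; `c_w E₀ + ϱ < R`; the FIRST-ORDER real last-coupling row `hGt` (`‖E(t) − E(t′)‖ ≤ e^{−r₁ d}·lam·|t − t′|` on the class, `lam ≤ ℓ₁`); S25's located
  configuration-chart block; rows `ω₁ ≤ μ`, `4M_b c_w∕ϱ ≤ μ`, `μ ≤ ℓ.ω`, `ℓ.κ ≤ δ₁`, `hrow` ⟹ `NE9 ((objectsOfRecord₁₃ F N θ ℓ).EA 0) (Window θ.γ) ℓ.κ ℓ.moduli`.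
* §2 ★★★ `ne9_EA_objectsOfRecord₁₃_of_termDataTableGermsLawsRoad1Max` — §1 with `hcv` DISCHARGED from def-W1's laws by N10 106 `𝒱_tableGerms_reading` (as J68 §2).
* §3 ★★★ socket `n22At_u3OfRecord₁₃_of_termDataTableGermsLawsRoad1Max` — §2 ⟹ `N22At (u3OfRecord₁₃ θ (objectsOfRecord₁₃ F N θ ℓ) k)` for every run length `k` (dag-n27-c's `h22`
  row; plug = leaf `…OneTermN22GenAnalyticReadingRoad1Max`'s shape with `Gn ↦ (𝔇 ·).Gn`, `κE ↦ r₁`, `r₀ ↦ c_w E₀`, the block `Adm hAdm ρA A hGA hA hMbA hAdmr hρ₁ haw` replaced by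
  `hsp hE₀ hRA hD χu χcu 𝒲 𝒪 Rd W hlaw hread hmaps hW c hL hLc hN hT hA0 hr₁ hrate hsmall hrenew hawpos hawcw`, `hGt` guarded by the class).
After J71, ROAD 1's older-term side at def-W1's term data = def-W1's laws + PER TERM `hT` (N10's module 107 locates it, cf. J69) + `RecAdmissible`; its last-coupling side = the
first-order real Lipschitz row `hGt` ([I] p. 263 «C^∞ in g», p. 266 — qualitative in print; constants not printed).

HONEST FRAMING (binding).  Count-neutral COMPOSITION of tree theorems BY NAME (J65; N10 102 §3 ∕ 105 ∕ 106; def-W1's class + `recTerm_zero`); `hT`, `hGt`, the laws, the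
bookkeeping, the numerics, the clause and every other binder are DISPLAYED HYPOTHESES (GAPS G-ne9p2-5 ∕ G-t4-U3-1); NO estimate of Bałaban's is proved or asserted; nothing of the
record is constructed or claimed to meet the displayed inputs.  N10 and N22 are NOT discharged (typed 28∕28 · discharged 5∕27 UNCHANGED); K3⁸ OPEN and NOT claimed; NE9 is NOT
IN PRINT for d = 4; no count claim; one finite 𝕋⁴ programme at fixed ε — R4 closes the CONDITIONAL rung `BalabanLadder.UV` only; NOTHING about the continuum limit, ℝ⁴, infinite
volume, OS axioms, a mass gap or the Clay problem is proved or claimed.  References (TYPES only): [II] = Bałaban, CMP 116 (1988) (1.41) p. 11, (2.14)–(2.15) p. 15, (2.26) p. 17,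
Lemma 3 (2.38) p. 20, (2.39)–(2.41) p. 21; [I] = CMP 109 (1987) (1.18) p. 263, p. 266, (2.9)–(2.13) pp. 266–268, (4.35)–(4.37) pp. 290–291; Kotecký–Preiss, CMP 103 (1986)
Thm p. 492; King, CMP 102 (1986) Lemma 4.5 (4.38).
-/

noncomputable section

open Set Metric
open scoped BigOperators

namespace YMDAG.N22.KernelFading

open Literature.MathematicalPhysics.QuantumFieldTheory.Balaban1983to89
open Literature.MathematicalPhysics.QuantumFieldTheory.Balaban1983to89.T4Continuum (T4Family ULoop)
open Literature.MathematicalPhysics.QuantumFieldTheory.Balaban1983to89.T4OutputRate (Window NE9)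
open Literature.MathematicalPhysics.QuantumFieldTheory.Balaban1983to89.TreeLengthTorus (TPt TDom tsys torusTreeLen)
open Literature.MathematicalPhysics.QuantumFieldTheory.Balaban1983to89.B12TreeDecay (K₀ kappa₀)
open Literature.MathematicalPhysics.QuantumFieldTheory.Balaban1983to89.B12Decay510 (delta1)
open Literature.MathematicalPhysics.QuantumFieldTheory.Balaban1983to89.B12Decay510Window (K₁)
open Literature.MathematicalPhysics.QuantumFieldTheory.Balaban1983to89.B12Decay510Torus (distCT nearT)
open Literature.MathematicalPhysics.QuantumFieldTheory.Balaban1983to89.B13Lemma3TorusData (TBond)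
open Literature.MathematicalPhysics.QuantumFieldTheory.Balaban1983to89.B13Lemma3TorusTerms (terms weight)
open Literature.MathematicalPhysics.QuantumFieldTheory.Balaban1983to89.B13Lemma3TorusSocket (Lemma3Numerics)
open Literature.MathematicalPhysics.QuantumFieldTheory.Balaban1983to89.B13OlderTermsTableGerms (Pot cv ρ norm_ρ_le_of_admHist norm_ρ_sub_ρ_le
  norm_ρ_threePoint_le)
open Literature.MathematicalPhysics.QuantumFieldTheory.Balaban1983to89.Node00 (Stage13Params Stage13HParams U3Letters₁₁ MatA)
open Literature.MathematicalPhysics.QuantumFieldTheory.Balaban1983to89.Node00.Sect2 (domSys domCount CPair)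
open Literature.MathematicalPhysics.QuantumFieldTheory.Balaban1983to89.Node00.W1
open Literature.MathematicalPhysics.QuantumFieldTheory.Balaban1983to89.Node00.LocalizedSum17 (ReadingMaps Localizes17OfRecord₁₃)
open Literature.MathematicalPhysics.QuantumFieldTheory.Balaban1983to89.Node00.U3OfKernels (histPrefix objectsOfRecord₁₃)
open Literature.MathematicalPhysics.QuantumFieldTheory.Balaban1983to89.Node00.U3KernelLetters (PolLimitsExistOfRecord₁₃)
open YMDAG.UVSplit (N22At u3OfRecord₁₃ RateReading₁₃CoPH rateCarriersOfRecord₁₃CoPH)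
open YMDAG.N22.AtKernels (n22At_u3OfRecord₁₃_objectsOfRecord₁₃_iff)
open YMDAG.N10 (exists_genAnalyticReading_termData_of_termwise226 𝒱_tableGerms_reading)

open scoped Matrix.Norms.L2Operator

variable (F : T4Family) (N : ℕ) [NeZero N] {𝔸 : Type} [NormedRing 𝔸] [NormedAlgebra ℂ 𝔸]

/-! ## §1 ★★★ K3's `h9` on ROAD 1 (max clause) for def-W1's term data read on the table-germ carrier — NO node-N18 letter, NO last-coupling sector -/

open Classical Finset in
/-- ★★★ **K3's `h9` ON ROAD 1 (MAX CLAUSE) FOR def-W1's (2.14) TERM DATA READ ON N10's TABLE-GERM CARRIER** — module J65 with `A hGA hA hMbA` := N10 102 §3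
`exists_genAnalyticReading_termData_of_termwise226` (from the reading section `hcv` + PER TERM `hT`; rate `κ_E = r₁`, `M_b ≥ e·9·64·K₀(64,8)²·C₃ε₁`), `hAdmr hρ₁` := module 105's
all-level rows on the class `AdmHist ∧ (old 0 = 0)` (`r₀ = c_w E₀`), `hAdm` := `RecAdmissible (𝔇 K).Gn (D K) (AdmHist (sp K) E₀ r₁)` + `]0,γ] ⊆ D K` + `recTerm_zero`.  Inputs left: (1.21);
W1-20's law; open tables; `hcv`; `hT` per term; numerics + [KP86] clauses + renewal; level weights `0 < aw K k j ≤ c_w`, `aw K k j ≤ c_w ω₁^{k−j}`; `c_w E₀ + ϱ < R`; the FIRST-ORDER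
real last-coupling Lipschitz row `hGt` of `((𝔇 K).Gn k).E` (rate `r₁`, `lam ≤ ℓ₁`); S25's chart block; the max clause and `hrow` ⟹ **`NE9 ((objectsOfRecord₁₃ F N θ ℓ).EA 0) (Window θ.γ)
ℓ.κ ℓ.moduli`** — NO node-N18 letter, NO sector holomorphy.  LOCATED (hypothesis form); N22 NOT discharged. [folklore] -/
theorem ne9_EA_objectsOfRecord₁₃_of_termDataTableGermsRoad1Max (θ : Stage13Params F N) (ℓ : U3Letters₁₁) (hs : ℓ.Signs) (hγ : 0 < θ.γ) (hlim : PolLimitsExistOfRecord₁₃ F N θ)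
    (m' : ℕ) (M : ℕ) [NeZero M] (hM : M = F.L ^ m')
    {c₀ : B13.Consts} {L : ℕ} [NeZero L] (𝔇 : (K : ℕ) → TermData214 c₀ (F.P K) 𝔸 M L) (emb : ReadingMaps F (MatA N) 𝔸)
    (hloc : Localizes17OfRecord₁₃ F N θ (fun K => truncRun K (toClusterTower (𝔇 K).Gn)) emb)
    (sp : (K j : ℕ) → (domSys (F.P K) M j).Dom → Set (CPair (F.P K) 𝔸))
    (hsp : ∀ (K j : ℕ) (Y : (domSys (F.P K) M j).Dom), IsOpen (sp K j Y))
    {κ δ₀ B₃ r ℓ₁ R E₀ ϱ Mb cw ω₁ μ r₁ : ℝ} {lam : ℕ → ℕ → ℝ} {aw : ℕ → ℕ → ℕ → ℝ}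
    (hκ₀ : kappa₀ (4 * 2 ^ 4) (2 * 4) ≤ κ / 2) (hδ₀ : 0 < δ₀) (hB₃ : 0 ≤ B₃) (hr : 0 < r) (hκE : κ ≤ r₁) (hE₀ : 0 ≤ E₀)
    {D : ℕ → Set ℂ} (hRA : ∀ K, RecAdmissible (𝔇 K).Gn (D K) (AdmHist (sp K) E₀ r₁))
    (hD : ∀ K, ∀ t ∈ Ioc (0 : ℝ) θ.γ, ((t : ℝ) : ℂ) ∈ D K)
    (hcv : ∀ (K k : ℕ), ∀ t ∈ Ioc (0 : ℝ) θ.γ, ∀ (old : OlderTerms (F.P K) 𝔸 M k), old ∈ AdmHist (sp K) E₀ r₁ k →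
      ∀ (X : (domSys (F.P K) M (k + 1)).Dom), ∀ φ ∈ sp K (k + 1) X, ∀ Z : (domSys (F.P K) M (k + 1)).Dom, Subtype.val Z ⊆ Subtype.val X → ∀ s ∈ terms L M Z,
        ∀ Y B, (𝔇 K k).𝒱 Z s ((t : ℝ) : ℂ) (cv r₁ (fun j : Fin (k + 1) => aw K k j) (ρ (sp K) r₁ (fun j : Fin (k + 1) => aw K k j) old)) φ Y B =
          (𝔇 K k).𝒱 Z s ((t : ℝ) : ℂ) old φ Y B)
    (c : B13.Consts) (hL : 8 ≤ c.L) (hLc : c.L = L) {a a₂ a₂' a₅ Aabs : ℝ} (hN : Lemma3Numerics c M ((c.L : ℝ) / 2) a a₂ a₂' a₅ Aabs)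
    (hT : ∀ (K k : ℕ), ∀ t ∈ Ioc (0 : ℝ) θ.γ, ∀ (X : (domSys (F.P K) M (k + 1)).Dom), ∀ φ ∈ sp K (k + 1) X,
      ∀ Z : (domSys (F.P K) M (k + 1)).Dom, Subtype.val Z ⊆ Subtype.val X → ∀ s ∈ terms L M Z,
        DifferentiableOn ℂ (fun p : Pot k (sp K) => (𝔇 K k).TF Z s ((t : ℝ) : ℂ) (cv r₁ (fun j : Fin (k + 1) => aw K k j) p) φ) (ball 0 R) ∧
          ∀ p ∈ ball (0 : Pot k (sp K)) R,
            ‖(𝔇 K k).TF Z s ((t : ℝ) : ℂ) (cv r₁ (fun j : Fin (k + 1) => aw K k j) p) φ‖ ≤ weight L M c Z a s * Real.exp (a₅ * ((Z.1).card : ℝ)))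
    (hA0 : 0 ≤ c.C3act * c.ε₁) (hr₁ : 0 ≤ r₁) (hrate : r₁ + 2 * (64 * Real.log 162) + 2 ≤ (1 - 8 * c.δ) * ((c.L : ℝ) / 2) * c.κ)
    (hsmall : c.C3act * c.ε₁ * Real.exp (5 * r₁ + 1) * K₀ 64 8 * 9 * 64 ≤ 1) (hrenew : Real.exp 1 * 9 * 64 * K₀ 64 8 ^ 2 * (c.C3act * c.ε₁) ≤ Mb)
    (hawpos : ∀ K k j, 0 < aw K k j) (hawcw : ∀ K k j, aw K k j ≤ cw) (hawω : ∀ K k j, j ≤ k → aw K k j ≤ cw * ω₁ ^ (k - j)) (hϱ : 0 < ϱ) (hR : cw * E₀ + ϱ < R)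
    (hGt : ∀ (K k : ℕ), ∀ t ∈ Ioc (0 : ℝ) θ.γ, ∀ t' ∈ Ioc (0 : ℝ) θ.γ, ∀ (old : OlderTerms (F.P K) 𝔸 M k), old ∈ AdmHist (sp K) E₀ r₁ k ∧ old 0 = 0 →
      ∀ (X : (domSys (F.P K) M (k + 1)).Dom), ∀ φ ∈ sp K (k + 1) X,
        ‖((𝔇 K).Gn k).E ((t : ℝ) : ℂ) old φ X - ((𝔇 K).Gn k).E ((t' : ℝ) : ℂ) old φ X‖ ≤ Real.exp (-(r₁ * (domSys (F.P K) M (k + 1)).dj X)) * (lam K k * |t - t'|))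
    (hlam : ∀ K k, lam K k ≤ ℓ₁) (hℓ₁ : 0 ≤ ℓ₁) (hω₁ : 0 ≤ ω₁)
    (Ec : ℕ → ℕ → Type*) [∀ K k, NormedAddCommGroup (Ec K k)] [∀ K k, NormedSpace ℂ (Ec K k)]
    (ι : letI := θ.instVβ₁; letI := θ.instVβ₂
      (K k : ℕ) → (domSys (F.P K) M (k + 1)).Dom → ((Fin (F.P K).d → Site (F.P K) (k + 1) → θ.Vβ) →L[ℝ] Ec K k))
    (Φ : (K k : ℕ) → (domSys (F.P K) M (k + 1)).Dom → Ec K k → CPair (F.P K) 𝔸)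
    (U : (K k : ℕ) → (domSys (F.P K) M (k + 1)).Dom → Set (Ec K k)) (hU : ∀ K k X, IsOpen (U K k X)) (hrU : ∀ K k X, ball (0 : Ec K k) r ⊆ U K k X)
    (hEhol : ∀ g ∈ Window θ.γ, ∀ (K k : ℕ) (X : (domSys (F.P K) M (k + 1)).Dom),
      DifferentiableOn ℂ (fun z => (truncRun K (toClusterTower (𝔇 K).Gn) k).E (histPrefix g k) (Φ K k X z) X) (U K k X))
    (hΦemb : letI := θ.instVβ₁; letI := θ.instVβ₂
      ∀ (K k : ℕ) (X : (domSys (F.P K) M (k + 1)).Dom) (Bf : Fin (F.P K).d → Site (F.P K) (k + 1) → θ.Vβ),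
        Φ K k X (ι K k X Bf) = emb K k (fun l t => NormedSpace.exp (θ.ρ8 (Bf l t))))
    (hΦsp : ∀ (K k : ℕ) (X : (domSys (F.P K) M (k + 1)).Dom), ∀ z ∈ ball (0 : Ec K k) r, Φ K k X z ∈ sp K (k + 1) X)
    (w : (K k : ℕ) → (domSys (F.P K) M (k + 1)).Dom → Site (F.P K) (k + 1) → ℝ) (hw₀ : ∀ K k X t, 0 ≤ w K k X t)
    (hw : letI := θ.instVβ₁; letI := θ.instVβ₂; letI := θ.instιβ
      ∀ (K k : ℕ) (X : (domSys (F.P K) M (k + 1)).Dom) (l : Fin (F.P K).d) (t : Site (F.P K) (k + 1)) (c : θ.ιβ),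
        ‖ι K k X (Pi.single l (Pi.single t (θ.bV c)))‖ ≤ w K k X t)
    (htail : ∀ (K k : ℕ) (X : (domSys (F.P K) M (k + 1)).Dom) (t : Site (F.P K) (k + 1)),
      let e : Site (F.P K) (k + 1) → TPt 4 (domCount (F.P K) M (k + 1) * M) := fun x i => (ZMod.cast (x i) : ZMod (domCount (F.P K) M (k + 1) * M))
      w K k X t ≤ B₃ * Real.exp (-δ₀ * distCT (domCount (F.P K) M (k + 1)) M (e t) (nearT (M := M) (e t) X)))
    (hω₁μ : ω₁ ≤ μ) (hCμ : 4 * Mb * cw / ϱ ≤ μ) (hμω : μ ≤ ℓ.ω) (hℓκ : ℓ.κ ≤ delta1 δ₀ κ ((M : ℝ) * 4))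
    (hrow : 16 * B₃ ^ 2 / r ^ 2 * Real.exp (delta1 δ₀ κ ((M : ℝ) * 4) * ((M : ℝ) * 4) * 3) * K₀ (4 * 2 ^ 4) (2 * 4) * K₁ 4 (δ₀ / 2) * ℓ₁ ≤ ℓ.C₉ * ℓ.ω) :
    NE9 ((objectsOfRecord₁₃ F N θ ℓ).EA 0) (Window θ.γ) ℓ.κ ℓ.moduli := by
  -- the admissibility class: def-W1's `AdmHist` AND a vanishing level-`0` slice (`recTerm_zero`, [I] (0.23))
  let Adm : (K k : ℕ) → OlderTerms (F.P K) 𝔸 M k → Prop := fun K k old => old ∈ AdmHist (sp K) E₀ r₁ k ∧ old 0 = 0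
  have hAdm : ∀ K, ∀ g ∈ Window θ.γ, ∀ k, Adm K k (olderOf (recTerm (𝔇 K).Gn fun n => ((g n : ℝ) : ℂ)) k) := fun K g hg k =>
    ⟨hRA K _ (fun n => hD K _ (hg n)) k, by funext X φ; simp [olderOf_apply, recTerm_zero]⟩
  -- N10 module 102 §3: the term-level analytic reading (AR-fact) ∧ (AR-holo) ∧ (AR-bound) at rate `r₁`, `M_b ≥ e·9·64·K₀²·C₃ε₁`
  obtain ⟨A', h1, h2, h3⟩ := exists_genAnalyticReading_termData_of_termwise226 F L 𝔇 (fun K k => sp K (k + 1)) Adm (Pot := fun K k => Pot k (sp K))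
    (fun K k => ρ (sp K) r₁ (fun j : Fin (k + 1) => aw K k j)) (fun K k => cv r₁ (fun j : Fin (k + 1) => aw K k j)) c hL hLc hN hA0 hr₁ hrate hsmall
    (fun K k t ht old hold => hcv K k t ht old hold.1) hT
  have hcw : (0 : ℝ) ≤ cw := (hawpos 0 0 0).le.trans (hawcw 0 0 0)
  -- N10 module 105's (AR-dom₁) at ALL levels; the level-`0` entries of the class vanish
  have hρ₁ : ∀ (K k : ℕ) (o o' : OlderTerms (F.P K) 𝔸 M k), Adm K k o → Adm K k o' → ∀ (B' : ℝ), 0 ≤ B' →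
      (∀ (k' : ℕ) (hk' : k' < k) (Y : (domSys (F.P K) M (k' + 1)).Dom), ∀ φ' ∈ sp K (k' + 1) Y,
        aw K k (k' + 1) * (Real.exp (r₁ * (domSys (F.P K) M (k' + 1)).dj Y) * ‖o ⟨k' + 1, Nat.succ_lt_succ hk'⟩ Y φ' - o' ⟨k' + 1, Nat.succ_lt_succ hk'⟩ Y φ'‖) ≤ B') →
      ‖ρ (sp K) r₁ (fun j : Fin (k + 1) => aw K k j) o - ρ (sp K) r₁ (fun j : Fin (k + 1) => aw K k j) o'‖ ≤ B' := fun K k o o' ho ho' B' hB' h =>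
    norm_ρ_sub_ρ_le r₁ (fun j : Fin (k + 1) => aw K k j) (hsp K) le_rfl hE₀ (fun j => (hawpos K k j).le) (fun j => hawcw K k j) ho.1 ho'.1 hB'
      fun j Y ψ hψ => by
        rcases Fin.eq_zero_or_eq_succ j with rfl | ⟨j', rfl⟩
        · simpa [ho.2, ho'.2] using hB'
        · exact h j'.1 j'.2 Y ψ hψ
  exact ne9_EA_objectsOfRecord₁₃_of_genAnalyticReadingRoad1Max F N θ ℓ hs hγ hlim m' M hM (fun K => (𝔇 K).Gn) emb hloc (fun K k => sp K (k + 1)) hκ₀ hδ₀ hB₃ hr hκE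
    Adm hAdm (Pot := fun K k => Pot k (sp K)) (fun K k => ρ (sp K) r₁ (fun j : Fin (k + 1) => aw K k j)) A' h1 h2
    (fun K k t ht X φ hφ p hp => (h3 K k t ht X φ hφ p hp).trans (mul_le_mul_of_nonneg_right hrenew (Real.exp_nonneg _)))
    (fun K k old hold => norm_ρ_le_of_admHist r₁ (fun j : Fin (k + 1) => aw K k j) (hsp K) le_rfl hE₀ (fun j => (hawpos K k j).le)
      (fun j => hawcw K k j) hcw hold.1)
    hρ₁ (fun K k j => (hawpos K k j).le) hawω hcw hϱ hR hGt hlam hℓ₁ hω₁ Ec ι Φ U hU hrU hEhol hΦemb hΦsp w hw₀ hw htail hω₁μ hCμ hμω hℓκ hrow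

/-! ## §2 ★★★ The same with the reading section DISCHARGED from def-W1's laws (N10 106) -/

open Classical Finset in
/-- ★★★ **THE SAME WITH THE READING SECTION DISCHARGED FROM def-W1's LAWS** (N10 106 `𝒱_tableGerms_reading`: unscaled-field law, `ReadsBy`, `MapsToTables` on windows
`W ⊇ sp K (k+1) X`).  LOCATED (hypothesis form); N22 NOT discharged. [folklore] -/
theorem ne9_EA_objectsOfRecord₁₃_of_termDataTableGermsLawsRoad1Max (θ : Stage13Params F N) (ℓ : U3Letters₁₁) (hs : ℓ.Signs) (hγ : 0 < θ.γ) (hlim : PolLimitsExistOfRecord₁₃ F N θ)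
    (m' : ℕ) (M : ℕ) [NeZero M] (hM : M = F.L ^ m')
    {c₀ : B13.Consts} {L : ℕ} [NeZero L] (𝔇 : (K : ℕ) → TermData214 c₀ (F.P K) 𝔸 M L) (emb : ReadingMaps F (MatA N) 𝔸)
    (hloc : Localizes17OfRecord₁₃ F N θ (fun K => truncRun K (toClusterTower (𝔇 K).Gn)) emb)
    (sp : (K j : ℕ) → (domSys (F.P K) M j).Dom → Set (CPair (F.P K) 𝔸))
    (hsp : ∀ (K j : ℕ) (Y : (domSys (F.P K) M j).Dom), IsOpen (sp K j Y))
    {κ δ₀ B₃ r ℓ₁ R E₀ ϱ Mb cw ω₁ μ r₁ : ℝ} {lam : ℕ → ℕ → ℝ} {aw : ℕ → ℕ → ℕ → ℝ}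
    (hκ₀ : kappa₀ (4 * 2 ^ 4) (2 * 4) ≤ κ / 2) (hδ₀ : 0 < δ₀) (hB₃ : 0 ≤ B₃) (hr : 0 < r) (hκE : κ ≤ r₁) (hE₀ : 0 ≤ E₀)
    {D : ℕ → Set ℂ} (hRA : ∀ K, RecAdmissible (𝔇 K).Gn (D K) (AdmHist (sp K) E₀ r₁))
    (hD : ∀ K, ∀ t ∈ Ioc (0 : ℝ) θ.γ, ((t : ℝ) : ℂ) ∈ D K)
    {S : ℕ → ℕ → Type} [∀ K k, MeasurableSpace (S K k)]
    (χu χcu : (K k : ℕ) → (𝔇 K k).UnscaledChi) (𝒲 : (K k : ℕ) → (𝔇 K k).UnscaledWilson) (𝒪 : (K k : ℕ) → (𝔇 K k).UnscaledOlder)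
    (Rd : (K k : ℕ) → (Z : (domSys (F.P K) M (k + 1)).Dom) → (t : TermLabel (F.P K) M k L) → (𝔇 K k).ReadingAtoms Z t (S K k))
    (W : (K k : ℕ) → (domSys (F.P K) M (k + 1)).Dom → TermLabel (F.P K) M k L → Set (CPair (F.P K) 𝔸))
    (hlaw : ∀ K, (𝔇 K).UnscaledFieldLawOn (χu K) (χcu K) (𝒲 K) (𝒪 K) θ.γ) (hread : ∀ K k, (𝔇 K k).ReadsBy (𝒪 K k) (Rd K k))
    (hmaps : ∀ (K k : ℕ) (Z : (domSys (F.P K) M (k + 1)).Dom) (t : TermLabel (F.P K) M k L), (Rd K k Z t).MapsToTables (sp K) (W K k Z t) univ)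
    (hW : ∀ (K k : ℕ) (X Z : (domSys (F.P K) M (k + 1)).Dom), Subtype.val Z ⊆ Subtype.val X → ∀ s ∈ terms L M Z, sp K (k + 1) X ⊆ W K k Z s)
    (c : B13.Consts) (hL : 8 ≤ c.L) (hLc : c.L = L) {a a₂ a₂' a₅ Aabs : ℝ} (hN : Lemma3Numerics c M ((c.L : ℝ) / 2) a a₂ a₂' a₅ Aabs)
    (hT : ∀ (K k : ℕ), ∀ t ∈ Ioc (0 : ℝ) θ.γ, ∀ (X : (domSys (F.P K) M (k + 1)).Dom), ∀ φ ∈ sp K (k + 1) X,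
      ∀ Z : (domSys (F.P K) M (k + 1)).Dom, Subtype.val Z ⊆ Subtype.val X → ∀ s ∈ terms L M Z,
        DifferentiableOn ℂ (fun p : Pot k (sp K) => (𝔇 K k).TF Z s ((t : ℝ) : ℂ) (cv r₁ (fun j : Fin (k + 1) => aw K k j) p) φ) (ball 0 R) ∧
          ∀ p ∈ ball (0 : Pot k (sp K)) R,
            ‖(𝔇 K k).TF Z s ((t : ℝ) : ℂ) (cv r₁ (fun j : Fin (k + 1) => aw K k j) p) φ‖ ≤ weight L M c Z a s * Real.exp (a₅ * ((Z.1).card : ℝ)))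
    (hA0 : 0 ≤ c.C3act * c.ε₁) (hr₁ : 0 ≤ r₁) (hrate : r₁ + 2 * (64 * Real.log 162) + 2 ≤ (1 - 8 * c.δ) * ((c.L : ℝ) / 2) * c.κ)
    (hsmall : c.C3act * c.ε₁ * Real.exp (5 * r₁ + 1) * K₀ 64 8 * 9 * 64 ≤ 1) (hrenew : Real.exp 1 * 9 * 64 * K₀ 64 8 ^ 2 * (c.C3act * c.ε₁) ≤ Mb)
    (hawpos : ∀ K k j, 0 < aw K k j) (hawcw : ∀ K k j, aw K k j ≤ cw) (hawω : ∀ K k j, j ≤ k → aw K k j ≤ cw * ω₁ ^ (k - j)) (hϱ : 0 < ϱ) (hR : cw * E₀ + ϱ < R)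
    (hGt : ∀ (K k : ℕ), ∀ t ∈ Ioc (0 : ℝ) θ.γ, ∀ t' ∈ Ioc (0 : ℝ) θ.γ, ∀ (old : OlderTerms (F.P K) 𝔸 M k), old ∈ AdmHist (sp K) E₀ r₁ k ∧ old 0 = 0 →
      ∀ (X : (domSys (F.P K) M (k + 1)).Dom), ∀ φ ∈ sp K (k + 1) X,
        ‖((𝔇 K).Gn k).E ((t : ℝ) : ℂ) old φ X - ((𝔇 K).Gn k).E ((t' : ℝ) : ℂ) old φ X‖ ≤ Real.exp (-(r₁ * (domSys (F.P K) M (k + 1)).dj X)) * (lam K k * |t - t'|))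
    (hlam : ∀ K k, lam K k ≤ ℓ₁) (hℓ₁ : 0 ≤ ℓ₁) (hω₁ : 0 ≤ ω₁)
    (Ec : ℕ → ℕ → Type*) [∀ K k, NormedAddCommGroup (Ec K k)] [∀ K k, NormedSpace ℂ (Ec K k)]
    (ι : letI := θ.instVβ₁; letI := θ.instVβ₂
      (K k : ℕ) → (domSys (F.P K) M (k + 1)).Dom → ((Fin (F.P K).d → Site (F.P K) (k + 1) → θ.Vβ) →L[ℝ] Ec K k))
    (Φ : (K k : ℕ) → (domSys (F.P K) M (k + 1)).Dom → Ec K k → CPair (F.P K) 𝔸)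
    (U : (K k : ℕ) → (domSys (F.P K) M (k + 1)).Dom → Set (Ec K k)) (hU : ∀ K k X, IsOpen (U K k X)) (hrU : ∀ K k X, ball (0 : Ec K k) r ⊆ U K k X)
    (hEhol : ∀ g ∈ Window θ.γ, ∀ (K k : ℕ) (X : (domSys (F.P K) M (k + 1)).Dom),
      DifferentiableOn ℂ (fun z => (truncRun K (toClusterTower (𝔇 K).Gn) k).E (histPrefix g k) (Φ K k X z) X) (U K k X))
    (hΦemb : letI := θ.instVβ₁; letI := θ.instVβ₂
      ∀ (K k : ℕ) (X : (domSys (F.P K) M (k + 1)).Dom) (Bf : Fin (F.P K).d → Site (F.P K) (k + 1) → θ.Vβ),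
        Φ K k X (ι K k X Bf) = emb K k (fun l t => NormedSpace.exp (θ.ρ8 (Bf l t))))
    (hΦsp : ∀ (K k : ℕ) (X : (domSys (F.P K) M (k + 1)).Dom), ∀ z ∈ ball (0 : Ec K k) r, Φ K k X z ∈ sp K (k + 1) X)
    (w : (K k : ℕ) → (domSys (F.P K) M (k + 1)).Dom → Site (F.P K) (k + 1) → ℝ) (hw₀ : ∀ K k X t, 0 ≤ w K k X t)
    (hw : letI := θ.instVβ₁; letI := θ.instVβ₂; letI := θ.instιβ
      ∀ (K k : ℕ) (X : (domSys (F.P K) M (k + 1)).Dom) (l : Fin (F.P K).d) (t : Site (F.P K) (k + 1)) (c : θ.ιβ),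
        ‖ι K k X (Pi.single l (Pi.single t (θ.bV c)))‖ ≤ w K k X t)
    (htail : ∀ (K k : ℕ) (X : (domSys (F.P K) M (k + 1)).Dom) (t : Site (F.P K) (k + 1)),
      let e : Site (F.P K) (k + 1) → TPt 4 (domCount (F.P K) M (k + 1) * M) := fun x i => (ZMod.cast (x i) : ZMod (domCount (F.P K) M (k + 1) * M))
      w K k X t ≤ B₃ * Real.exp (-δ₀ * distCT (domCount (F.P K) M (k + 1)) M (e t) (nearT (M := M) (e t) X)))
    (hω₁μ : ω₁ ≤ μ) (hCμ : 4 * Mb * cw / ϱ ≤ μ) (hμω : μ ≤ ℓ.ω) (hℓκ : ℓ.κ ≤ delta1 δ₀ κ ((M : ℝ) * 4))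
    (hrow : 16 * B₃ ^ 2 / r ^ 2 * Real.exp (delta1 δ₀ κ ((M : ℝ) * 4) * ((M : ℝ) * 4) * 3) * K₀ (4 * 2 ^ 4) (2 * 4) * K₁ 4 (δ₀ / 2) * ℓ₁ ≤ ℓ.C₉ * ℓ.ω) :
    NE9 ((objectsOfRecord₁₃ F N θ ℓ).EA 0) (Window θ.γ) ℓ.κ ℓ.moduli :=
  ne9_EA_objectsOfRecord₁₃_of_termDataTableGermsRoad1Max F N
    θ ℓ hs hγ hlim m' M hM 𝔇 emb hloc sp hsp hκ₀ hδ₀ hB₃ hr hκE hE₀ hRA hD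
    (fun K k _ ht _ hold X _ hφ Z hZ s hs' Y B => 𝒱_tableGerms_reading (𝔇 K k) (sp K) r₁ (fun j : Fin (k + 1) => aw K k j) (Rd K k) (W K k)
        (hlaw K k) (hread K k) (hmaps K k) (hsp K) le_rfl hE₀ (fun j => hawpos K k j) (fun j => hawcw K k j) ht hold (hW K k X Z hZ s hs' hφ) Y B)
    c hL hLc hN hT hA0 hr₁ hrate hsmall hrenew hawpos hawcw hawω hϱ hR hGt hlam hℓ₁ hω₁ Ec ι Φ U hU hrU hEhol hΦemb hΦsp w hw₀ hw htail hω₁μ hCμ hμω hℓκ hrow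

/-! ## §3 ★★★ The kernel-face socket on ROAD 1 -/

open Classical Finset in
/-- ★★★ **THE KERNEL-FACE SOCKET ON ROAD 1 FOR def-W1's TERM DATA, LAWS EDITION** — §2's inputs ⟹ **`N22At (u3OfRecord₁₃ θ (objectsOfRecord₁₃ F N θ ℓ) k)` for EVERY run
length `k`** (dag-n27-c's `h22` row).  LOCATED (hypothesis form); N22 NOT discharged. [folklore] -/
theorem n22At_u3OfRecord₁₃_of_termDataTableGermsLawsRoad1Max (θ : Stage13Params F N) (ℓ : U3Letters₁₁) (hs : ℓ.Signs) (hγ : 0 < θ.γ) (hlim : PolLimitsExistOfRecord₁₃ F N θ)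
    (m' : ℕ) (M : ℕ) [NeZero M] (hM : M = F.L ^ m')
    {c₀ : B13.Consts} {L : ℕ} [NeZero L] (𝔇 : (K : ℕ) → TermData214 c₀ (F.P K) 𝔸 M L) (emb : ReadingMaps F (MatA N) 𝔸)
    (hloc : Localizes17OfRecord₁₃ F N θ (fun K => truncRun K (toClusterTower (𝔇 K).Gn)) emb)
    (sp : (K j : ℕ) → (domSys (F.P K) M j).Dom → Set (CPair (F.P K) 𝔸))
    (hsp : ∀ (K j : ℕ) (Y : (domSys (F.P K) M j).Dom), IsOpen (sp K j Y))
    {κ δ₀ B₃ r ℓ₁ R E₀ ϱ Mb cw ω₁ μ r₁ : ℝ} {lam : ℕ → ℕ → ℝ} {aw : ℕ → ℕ → ℕ → ℝ}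
    (hκ₀ : kappa₀ (4 * 2 ^ 4) (2 * 4) ≤ κ / 2) (hδ₀ : 0 < δ₀) (hB₃ : 0 ≤ B₃) (hr : 0 < r) (hκE : κ ≤ r₁) (hE₀ : 0 ≤ E₀)
    {D : ℕ → Set ℂ} (hRA : ∀ K, RecAdmissible (𝔇 K).Gn (D K) (AdmHist (sp K) E₀ r₁))
    (hD : ∀ K, ∀ t ∈ Ioc (0 : ℝ) θ.γ, ((t : ℝ) : ℂ) ∈ D K)
    {S : ℕ → ℕ → Type} [∀ K k, MeasurableSpace (S K k)]
    (χu χcu : (K k : ℕ) → (𝔇 K k).UnscaledChi) (𝒲 : (K k : ℕ) → (𝔇 K k).UnscaledWilson) (𝒪 : (K k : ℕ) → (𝔇 K k).UnscaledOlder)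
    (Rd : (K k : ℕ) → (Z : (domSys (F.P K) M (k + 1)).Dom) → (t : TermLabel (F.P K) M k L) → (𝔇 K k).ReadingAtoms Z t (S K k))
    (W : (K k : ℕ) → (domSys (F.P K) M (k + 1)).Dom → TermLabel (F.P K) M k L → Set (CPair (F.P K) 𝔸))
    (hlaw : ∀ K, (𝔇 K).UnscaledFieldLawOn (χu K) (χcu K) (𝒲 K) (𝒪 K) θ.γ) (hread : ∀ K k, (𝔇 K k).ReadsBy (𝒪 K k) (Rd K k))
    (hmaps : ∀ (K k : ℕ) (Z : (domSys (F.P K) M (k + 1)).Dom) (t : TermLabel (F.P K) M k L), (Rd K k Z t).MapsToTables (sp K) (W K k Z t) univ)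
    (hW : ∀ (K k : ℕ) (X Z : (domSys (F.P K) M (k + 1)).Dom), Subtype.val Z ⊆ Subtype.val X → ∀ s ∈ terms L M Z, sp K (k + 1) X ⊆ W K k Z s)
    (c : B13.Consts) (hL : 8 ≤ c.L) (hLc : c.L = L) {a a₂ a₂' a₅ Aabs : ℝ} (hN : Lemma3Numerics c M ((c.L : ℝ) / 2) a a₂ a₂' a₅ Aabs)
    (hT : ∀ (K k : ℕ), ∀ t ∈ Ioc (0 : ℝ) θ.γ, ∀ (X : (domSys (F.P K) M (k + 1)).Dom), ∀ φ ∈ sp K (k + 1) X,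
      ∀ Z : (domSys (F.P K) M (k + 1)).Dom, Subtype.val Z ⊆ Subtype.val X → ∀ s ∈ terms L M Z,
        DifferentiableOn ℂ (fun p : Pot k (sp K) => (𝔇 K k).TF Z s ((t : ℝ) : ℂ) (cv r₁ (fun j : Fin (k + 1) => aw K k j) p) φ) (ball 0 R) ∧
          ∀ p ∈ ball (0 : Pot k (sp K)) R,
            ‖(𝔇 K k).TF Z s ((t : ℝ) : ℂ) (cv r₁ (fun j : Fin (k + 1) => aw K k j) p) φ‖ ≤ weight L M c Z a s * Real.exp (a₅ * ((Z.1).card : ℝ)))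
    (hA0 : 0 ≤ c.C3act * c.ε₁) (hr₁ : 0 ≤ r₁) (hrate : r₁ + 2 * (64 * Real.log 162) + 2 ≤ (1 - 8 * c.δ) * ((c.L : ℝ) / 2) * c.κ)
    (hsmall : c.C3act * c.ε₁ * Real.exp (5 * r₁ + 1) * K₀ 64 8 * 9 * 64 ≤ 1) (hrenew : Real.exp 1 * 9 * 64 * K₀ 64 8 ^ 2 * (c.C3act * c.ε₁) ≤ Mb)
    (hawpos : ∀ K k j, 0 < aw K k j) (hawcw : ∀ K k j, aw K k j ≤ cw) (hawω : ∀ K k j, j ≤ k → aw K k j ≤ cw * ω₁ ^ (k - j)) (hϱ : 0 < ϱ) (hR : cw * E₀ + ϱ < R)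
    (hGt : ∀ (K k : ℕ), ∀ t ∈ Ioc (0 : ℝ) θ.γ, ∀ t' ∈ Ioc (0 : ℝ) θ.γ, ∀ (old : OlderTerms (F.P K) 𝔸 M k), old ∈ AdmHist (sp K) E₀ r₁ k ∧ old 0 = 0 →
      ∀ (X : (domSys (F.P K) M (k + 1)).Dom), ∀ φ ∈ sp K (k + 1) X,
        ‖((𝔇 K).Gn k).E ((t : ℝ) : ℂ) old φ X - ((𝔇 K).Gn k).E ((t' : ℝ) : ℂ) old φ X‖ ≤ Real.exp (-(r₁ * (domSys (F.P K) M (k + 1)).dj X)) * (lam K k * |t - t'|))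
    (hlam : ∀ K k, lam K k ≤ ℓ₁) (hℓ₁ : 0 ≤ ℓ₁) (hω₁ : 0 ≤ ω₁)
    (Ec : ℕ → ℕ → Type*) [∀ K k, NormedAddCommGroup (Ec K k)] [∀ K k, NormedSpace ℂ (Ec K k)]
    (ι : letI := θ.instVβ₁; letI := θ.instVβ₂
      (K k : ℕ) → (domSys (F.P K) M (k + 1)).Dom → ((Fin (F.P K).d → Site (F.P K) (k + 1) → θ.Vβ) →L[ℝ] Ec K k))
    (Φ : (K k : ℕ) → (domSys (F.P K) M (k + 1)).Dom → Ec K k → CPair (F.P K) 𝔸)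
    (U : (K k : ℕ) → (domSys (F.P K) M (k + 1)).Dom → Set (Ec K k)) (hU : ∀ K k X, IsOpen (U K k X)) (hrU : ∀ K k X, ball (0 : Ec K k) r ⊆ U K k X)
    (hEhol : ∀ g ∈ Window θ.γ, ∀ (K k : ℕ) (X : (domSys (F.P K) M (k + 1)).Dom),
      DifferentiableOn ℂ (fun z => (truncRun K (toClusterTower (𝔇 K).Gn) k).E (histPrefix g k) (Φ K k X z) X) (U K k X))
    (hΦemb : letI := θ.instVβ₁; letI := θ.instVβ₂
      ∀ (K k : ℕ) (X : (domSys (F.P K) M (k + 1)).Dom) (Bf : Fin (F.P K).d → Site (F.P K) (k + 1) → θ.Vβ),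
        Φ K k X (ι K k X Bf) = emb K k (fun l t => NormedSpace.exp (θ.ρ8 (Bf l t))))
    (hΦsp : ∀ (K k : ℕ) (X : (domSys (F.P K) M (k + 1)).Dom), ∀ z ∈ ball (0 : Ec K k) r, Φ K k X z ∈ sp K (k + 1) X)
    (w : (K k : ℕ) → (domSys (F.P K) M (k + 1)).Dom → Site (F.P K) (k + 1) → ℝ) (hw₀ : ∀ K k X t, 0 ≤ w K k X t)
    (hw : letI := θ.instVβ₁; letI := θ.instVβ₂; letI := θ.instιβ
      ∀ (K k : ℕ) (X : (domSys (F.P K) M (k + 1)).Dom) (l : Fin (F.P K).d) (t : Site (F.P K) (k + 1)) (c : θ.ιβ),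
        ‖ι K k X (Pi.single l (Pi.single t (θ.bV c)))‖ ≤ w K k X t)
    (htail : ∀ (K k : ℕ) (X : (domSys (F.P K) M (k + 1)).Dom) (t : Site (F.P K) (k + 1)),
      let e : Site (F.P K) (k + 1) → TPt 4 (domCount (F.P K) M (k + 1) * M) := fun x i => (ZMod.cast (x i) : ZMod (domCount (F.P K) M (k + 1) * M))
      w K k X t ≤ B₃ * Real.exp (-δ₀ * distCT (domCount (F.P K) M (k + 1)) M (e t) (nearT (M := M) (e t) X)))
    (hω₁μ : ω₁ ≤ μ) (hCμ : 4 * Mb * cw / ϱ ≤ μ) (hμω : μ ≤ ℓ.ω) (hℓκ : ℓ.κ ≤ delta1 δ₀ κ ((M : ℝ) * 4))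
    (hrow : 16 * B₃ ^ 2 / r ^ 2 * Real.exp (delta1 δ₀ κ ((M : ℝ) * 4) * ((M : ℝ) * 4) * 3) * K₀ (4 * 2 ^ 4) (2 * 4) * K₁ 4 (δ₀ / 2) * ℓ₁ ≤ ℓ.C₉ * ℓ.ω) (k : ℕ) :
    N22At (u3OfRecord₁₃ θ (objectsOfRecord₁₃ F N θ ℓ) k) :=
  (n22At_u3OfRecord₁₃_objectsOfRecord₁₃_iff F N θ ℓ hs k).2
    (ne9_EA_objectsOfRecord₁₃_of_termDataTableGermsLawsRoad1Max F N
      θ ℓ hs hγ hlim m' M hM 𝔇 emb hloc sp hsp hκ₀ hδ₀ hB₃ hr hκE hE₀ hRA hD χu χcu 𝒲 𝒪 Rd W hlaw hread hmaps hW c hL hLc hN hT hA0 hr₁ hrate hsmall hrenew hawpos hawcw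
      hawω hϱ hR hGt hlam hℓ₁ hω₁ Ec ι Φ U hU hrU hEhol hΦemb hΦsp w hw₀ hw htail hω₁μ hCμ hμω hℓκ hrow)

end YMDAG.N22.KernelFading

end
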